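import Summits.ValiantsHypothesis.ValiantsHypothesis.Theorems.FreeSubtorusOrbitDimensionBoundStubPerSummandPrelimC

/-!
# `OrbitDimensionBound` (stmt-ValiantsHypothesis-16133), rung line `sign_covering` — stub `stub_perSummand`,
# the Krull–Schmidt EXCHANGE: a local per-carrying retract of an equivariant representation is equivariant

Fourth tool file for stub 1 `stub_perSummand` of `Cruxes/OrbitDimensionBound/Lines/sign_covering.lean` (route
`FreeSubtorus`).  Main result `exists_lift_of_local_retract`: let `B ∈ M_m(ℂ[x_σ])` with `det B = c · f` (`f` irreducible,
`c ≠ 0`) admit an exact lift `B(γ·x) = G · B · H⁻¹` of a linear substitution `γ`, and let `N` (`det N = c' · f`) be a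
LOCAL retract of `B` (retract maps `v, u`; every endomorphism pair of `N` is `μ + nilpotent`).  Then `γ` lifts to `N`
as well: `N(γ·x) = g · N · h⁻¹` for some `g, h ∈ GL_k(ℂ)`.

Proof (the exchange argument of the Krull–Schmidt theorem, for square matrix pencils).  With `φ = (G, H) : B ≅ γB`,
`a = π^γ φ ι : N → γN`, `b = π φ⁻¹ ι^γ : γN → N` and the complement part `c = π φ⁻¹ (1 − ι^γ π^γ) φ ι ∈ End N` satisfy
`b a + c = 1`.  By locality `c = μ + nilpotent`.  If `μ ≠ 0` then `c` is invertible and `w = (1 − ι^γπ^γ) φ ι`,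
`z = c⁻¹ π φ⁻¹ (1 − ι^γ π^γ)` exhibit `N` as a retract of `γB` ORTHOGONAL to the retract `γN`; so `γN ⊕ N` is a retract of
`γB` and preliminaries B give `f(γx) · f(x) ∣ unit · f(γx)`, i.e. `f` is a unit — absurd.  Hence `μ = 0`, `c` is nilpotent,
`b a = 1 − c` is invertible, `a` has a left inverse, and (square matrices) `a` is invertible: the lift of `γ` to `N`.

Helper mode (`--supports stmt-ValiantsHypothesis-16133 --as helper`).  Honest framing: [folklore] algebra towards ONE
registered stub of a dormant rung line; `OrbitDimensionBound`, `FreeSubtorus` and VP ≠ VNP are OPEN and not moved.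

## References
* N. Jacobson, *Basic Algebra II*, 2nd ed. (1989), §3.4 (Krull–Schmidt theorem, exchange lemma) — orientation only.
* [LandsbergRessayre2017] J. M. Landsberg, N. Ressayre, Differential Geom. Appl. 55 (2017), Def. 1.3, §3.3.
-/

set_option linter.dupNamespace false

namespace Summit.ValiantsHypothesis.ValiantsHypothesis.Theorems.FreeSubtorusOrbitDimensionBound.SignCovering.PerSummand

open Matrix MvPolynomial Finset Module.End
open Literature.Computability.AlgebraicComplexity
open Summit.ValiantsHypothesis.ValiantsHypothesis.Theorems.FreeSubtorusConfusionCovering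

section Exchange

variable {σ : Type*} [Fintype σ] [DecidableEq σ]

/-- Substituting the variables in a morphism gives a morphism between the substituted matrices. [folklore] -/
theorem hom_linSubstEntries {ι κ : Type*} [Fintype ι] [Fintype κ] (γ : GL σ ℂ)
    {N₁ : Matrix ι ι (MvPolynomial σ ℂ)} {N₂ : Matrix κ κ (MvPolynomial σ ℂ)} {XW XV : Matrix κ ι ℂ}
    (hX : XW.map (C (σ := σ)) * N₁ = N₂ * XV.map (C (σ := σ))) :
    XW.map (C (σ := σ)) * Matrix.linSubstEntries γ N₁ = Matrix.linSubstEntries γ N₂ * XV.map (C (σ := σ)) := by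
  have h := congrArg (fun A : Matrix κ ι (MvPolynomial σ ℂ) => A.map (linSubst σ ℂ (γ : Matrix σ σ ℂ))) hX
  simp only [Matrix.map_mul] at h
  have h1 : (XW.map (C (σ := σ))).map (linSubst σ ℂ (γ : Matrix σ σ ℂ)) = XW.map (C (σ := σ)) := by
    ext i j; simp
  have h2 : (XV.map (C (σ := σ))).map (linSubst σ ℂ (γ : Matrix σ σ ℂ)) = XV.map (C (σ := σ)) := by
    ext i j; simp
  rw [h1, h2] at h
  exact h

omit [Fintype σ] [DecidableEq σ] in
/-- An element `μ · 1 + (nilpotent)` with `μ ≠ 0` is a unit. [folklore] -/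
theorem isUnit_of_isNilpotent_sub_smul_one {k : ℕ} {x : Matrix (Fin k) (Fin k) ℂ} {μ : ℂ} (hμ : μ ≠ 0)
    (hx : IsNilpotent (x - μ • (1 : Matrix (Fin k) (Fin k) ℂ))) : IsUnit x := by
  have hu : IsUnit (μ • (1 : Matrix (Fin k) (Fin k) ℂ)) := by
    rw [← Algebra.algebraMap_eq_smul_one]; exact (IsUnit.mk0 μ hμ).map _
  have hcomm : Commute (x - μ • (1 : Matrix (Fin k) (Fin k) ℂ)) (μ • (1 : Matrix (Fin k) (Fin k) ℂ)) :=
    (Commute.one_right _).smul_right μ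
  have h := hx.isUnit_add_left_of_commute hu hcomm
  rwa [add_sub_cancel] at h

omit [Fintype σ] [DecidableEq σ] in
/-- A square complex matrix with a left inverse is invertible (two-sided). [folklore] -/
theorem exists_two_sided_inverse {k : ℕ} {a y : Matrix (Fin k) (Fin k) ℂ} (h : y * a = 1) :
    a.det ≠ 0 ∧ a * y = 1 := by
  refine ⟨?_, mul_eq_one_comm.1 h⟩
  have h1 := congrArg Matrix.det h
  rw [Matrix.det_mul, Matrix.det_one, mul_comm] at h1
  exact left_ne_zero_of_mul_eq_one h1

/-- **Krull–Schmidt exchange for square matrix pencils.**  Let `f ∈ ℂ[x_σ]` be irreducible, `B ∈ M_m(ℂ[x_σ])` with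
`det B = c · f` (`c ≠ 0`) and an exact lift `B(γ·x) = G B H⁻¹` of the substitution `γ ∈ GL(σ)`, and let
`N ∈ M_k(ℂ[x_σ])`, `det N = c' · f` (`c' ≠ 0`), be a LOCAL retract of `B` (`v_W N = B v_V`, `u_W B = N u_V`,
`u v = 1`; every `(g, h)` with `g N = N h` is `μ + nilpotent` for one `μ`).  Then `γ` lifts to `N`:
`N(γ·x) = g N h⁻¹` with `g, h ∈ GL_k(ℂ)`. [folklore] -/
theorem exists_lift_of_local_retract {f : MvPolynomial σ ℂ} (hf : Irreducible f) {m k : ℕ}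
    (B : Matrix (Fin m) (Fin m) (MvPolynomial σ ℂ)) (c : ℂ) (hc : c ≠ 0) (hdetB : B.det = C c * f)
    (N : Matrix (Fin k) (Fin k) (MvPolynomial σ ℂ)) (c' : ℂ) (hc' : c' ≠ 0) (hdetN : N.det = C c' * f)
    (hloc : ∀ g h : Matrix (Fin k) (Fin k) ℂ, g.map C * N = N * h.map C →
      ∃ μ : ℂ, IsNilpotent (g - μ • (1 : Matrix (Fin k) (Fin k) ℂ)) ∧
        IsNilpotent (h - μ • (1 : Matrix (Fin k) (Fin k) ℂ)))
    (vW vV : Matrix (Fin m) (Fin k) ℂ) (uW uV : Matrix (Fin k) (Fin m) ℂ)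
    (hv : vW.map (C (σ := σ)) * N = B * vV.map (C (σ := σ)))
    (hu : uW.map (C (σ := σ)) * B = N * uV.map (C (σ := σ)))
    (huvW : uW * vW = 1) (huvV : uV * vV = 1)
    (γ : GL σ ℂ) (G H : GL (Fin m) ℂ)
    (hlift : Matrix.linSubstEntries γ B =
      (G : Matrix (Fin m) (Fin m) ℂ).map C * B * ((H⁻¹ : GL (Fin m) ℂ) : Matrix (Fin m) (Fin m) ℂ).map C) :
    ∃ g h : GL (Fin k) ℂ, Matrix.linSubstEntries γ N =
      (g : Matrix (Fin k) (Fin k) ℂ).map C * N * ((h⁻¹ : GL (Fin k) ℂ) : Matrix (Fin k) (Fin k) ℂ).map C := by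
  classical
  set γB := Matrix.linSubstEntries γ B with hγB
  set γN := Matrix.linSubstEntries γ N with hγN
  set Gm : Matrix (Fin m) (Fin m) ℂ := (G : Matrix (Fin m) (Fin m) ℂ) with hGm
  set Gi : Matrix (Fin m) (Fin m) ℂ := ((G⁻¹ : GL (Fin m) ℂ) : Matrix (Fin m) (Fin m) ℂ) with hGi
  set Hm : Matrix (Fin m) (Fin m) ℂ := (H : Matrix (Fin m) (Fin m) ℂ) with hHm
  set Hi : Matrix (Fin m) (Fin m) ℂ := ((H⁻¹ : GL (Fin m) ℂ) : Matrix (Fin m) (Fin m) ℂ) with hHi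
  have hGiG : Gi * Gm = 1 := by rw [hGi, hGm, ← Units.val_mul, inv_mul_cancel, Units.val_one]
  have hHiH : Hi * Hm = 1 := by rw [hHi, hHm, ← Units.val_mul, inv_mul_cancel, Units.val_one]
  have hHHi : Hm * Hi = 1 := by rw [hHi, hHm, ← Units.val_mul, mul_inv_cancel, Units.val_one]
  -- the isomorphism `φ = (G, H) : B → γB` and its inverse
  have hφ : Gm.map (C (σ := σ)) * B = γB * Hm.map (C (σ := σ)) := by
    rw [hlift, Matrix.mul_assoc, Matrix.mul_assoc, ← Matrix.map_mul, hHiH, Matrix.map_one C C_0 C_1,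
      Matrix.mul_one]
  have hφ' : Gi.map (C (σ := σ)) * γB = B * Hi.map (C (σ := σ)) := by
    rw [hlift, ← Matrix.mul_assoc, ← Matrix.mul_assoc, ← Matrix.map_mul, hGiG, Matrix.map_one C C_0 C_1,
      Matrix.one_mul]
  -- the substituted retract
  have hvγ : vW.map (C (σ := σ)) * γN = γB * vV.map (C (σ := σ)) := hom_linSubstEntries γ hv
  have huγ : uW.map (C (σ := σ)) * γB = γN * uV.map (C (σ := σ)) := hom_linSubstEntries γ hu
  -- the complementary idempotent `r = 1 - v u` of `γB`
  have hr : ((1 : Matrix (Fin m) (Fin m) ℂ) - vW * uW).map (C (σ := σ)) * γB =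
      γB * ((1 : Matrix (Fin m) (Fin m) ℂ) - vV * uV).map (C (σ := σ)) :=
    hom_sub (hom_one γB) (hom_comp huγ hvγ)
  have hrr : ∀ X : Matrix (Fin m) (Fin k) ℂ, (1 - vW * uW) * ((1 - vW * uW) * X) = (1 - vW * uW) * X := by
    intro X
    rw [← Matrix.mul_assoc]
    congr 1
    rw [Matrix.sub_mul, Matrix.one_mul, Matrix.mul_sub, Matrix.mul_one, Matrix.mul_assoc, ← Matrix.mul_assoc uW,
      huvW, Matrix.one_mul, sub_self, sub_zero]
  -- `a : N → γN`, `b : γN → N`, `c ∈ End N`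
  set aW : Matrix (Fin k) (Fin k) ℂ := uW * (Gm * vW) with haW
  set aV : Matrix (Fin k) (Fin k) ℂ := uV * (Hm * vV) with haV
  set bW : Matrix (Fin k) (Fin k) ℂ := uW * (Gi * vW) with hbW
  set cW : Matrix (Fin k) (Fin k) ℂ := uW * (Gi * ((1 - vW * uW) * (Gm * vW))) with hcW
  set cV : Matrix (Fin k) (Fin k) ℂ := uV * (Hi * ((1 - vV * uV) * (Hm * vV))) with hcV
  have ha : aW.map (C (σ := σ)) * N = γN * aV.map (C (σ := σ)) := hom_comp (hom_comp hv hφ) huγ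
  have hcN : cW.map (C (σ := σ)) * N = N * cV.map (C (σ := σ)) :=
    hom_comp (hom_comp (hom_comp (hom_comp hv hφ) hr) hφ') hu
  have hbac : bW * aW = 1 - cW := by
    have h1 : cW = uW * (Gi * (Gm * vW)) - uW * (Gi * (vW * uW * (Gm * vW))) := by
      rw [hcW, Matrix.sub_mul, Matrix.one_mul, Matrix.mul_sub, Matrix.mul_sub]
    have h2 : uW * (Gi * (Gm * vW)) = 1 := by rw [← Matrix.mul_assoc Gi, hGiG, Matrix.one_mul, huvW]
    have h3 : uW * (Gi * (vW * uW * (Gm * vW))) = bW * aW := by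
      simp only [hbW, haW, Matrix.mul_assoc]
    rw [h1, h2, h3, sub_sub_cancel]
  obtain ⟨μ, hμW, hμV⟩ := hloc cW cV hcN
  by_cases hμ : μ = 0
  · -- `c` nilpotent: `b a = 1 - c` is a unit, so `a` is invertible
    rw [hμ, zero_smul, sub_zero] at hμW hμV
    obtain ⟨yW, hyW⟩ : ∃ y : Matrix (Fin k) (Fin k) ℂ, y * aW = 1 := by
      obtain ⟨t, ht⟩ := hμW.isUnit_one_sub
      refine ⟨(↑t⁻¹ : Matrix (Fin k) (Fin k) ℂ) * bW, ?_⟩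
      rw [Matrix.mul_assoc, hbac, ← ht, Units.inv_mul]
    -- symmetric computation on the source side
    have hbacV : uV * (Hi * vV) * aV = 1 - cV := by
      have h1 : cV = uV * (Hi * (Hm * vV)) - uV * (Hi * (vV * uV * (Hm * vV))) := by
        rw [hcV, Matrix.sub_mul, Matrix.one_mul, Matrix.mul_sub, Matrix.mul_sub]
      have h2 : uV * (Hi * (Hm * vV)) = 1 := by rw [← Matrix.mul_assoc Hi, hHiH, Matrix.one_mul, huvV]
      have h3 : uV * (Hi * (vV * uV * (Hm * vV))) = uV * (Hi * vV) * aV := by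
        simp only [haV, Matrix.mul_assoc]
      rw [h1, h2, h3, sub_sub_cancel]
    obtain ⟨yV, hyV⟩ : ∃ y : Matrix (Fin k) (Fin k) ℂ, y * aV = 1 := by
      obtain ⟨t, ht⟩ := hμV.isUnit_one_sub
      refine ⟨(↑t⁻¹ : Matrix (Fin k) (Fin k) ℂ) * (uV * (Hi * vV)), ?_⟩
      rw [Matrix.mul_assoc, hbacV, ← ht, Units.inv_mul]
    obtain ⟨hdetaW, -⟩ := exists_two_sided_inverse hyW
    obtain ⟨hdetaV, haVy⟩ := exists_two_sided_inverse hyV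
    refine ⟨Matrix.GeneralLinearGroup.mkOfDetNeZero aW hdetaW, Matrix.GeneralLinearGroup.mkOfDetNeZero aV hdetaV, ?_⟩
    have hinv : ((Matrix.GeneralLinearGroup.mkOfDetNeZero aV hdetaV)⁻¹ : GL (Fin k) ℂ) = (yV : Matrix (Fin k) (Fin k) ℂ) := by
      rw [Matrix.coe_units_inv, Matrix.GeneralLinearGroup.val_mkOfDetNeZero]
      exact Matrix.inv_eq_right_inv haVy
    rw [hinv, Matrix.GeneralLinearGroup.val_mkOfDetNeZero, ha, Matrix.mul_assoc, ← Matrix.map_mul, haVy,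
      Matrix.map_one C C_0 C_1, Matrix.mul_one]
  · -- `c` invertible: `γN ⊕ N` would be a retract of `γB`
    exfalso
    obtain ⟨cWu, hcWu⟩ := isUnit_of_isNilpotent_sub_smul_one hμ hμW
    obtain ⟨cVu, hcVu⟩ := isUnit_of_isNilpotent_sub_smul_one hμ hμV
    set cWi : Matrix (Fin k) (Fin k) ℂ := (↑cWu⁻¹ : Matrix (Fin k) (Fin k) ℂ) with hcWi
    set cVi : Matrix (Fin k) (Fin k) ℂ := (↑cVu⁻¹ : Matrix (Fin k) (Fin k) ℂ) with hcVi
    have hcWicW : cWi * cW = 1 := by rw [hcWi, ← hcWu, Units.inv_mul]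
    have hcVcVi : cV * cVi = 1 := by rw [hcVi, ← hcVu, Units.mul_inv]
    -- `c⁻¹` is a morphism
    have hcinv : cWi.map (C (σ := σ)) * N = N * cVi.map (C (σ := σ)) := by
      calc cWi.map (C (σ := σ)) * N = cWi.map (C (σ := σ)) * N * (cV * cVi).map (C (σ := σ)) := by
            rw [hcVcVi, Matrix.map_one C C_0 C_1, Matrix.mul_one]
        _ = cWi.map (C (σ := σ)) * (cW.map (C (σ := σ)) * N) * cVi.map (C (σ := σ)) := by
            rw [Matrix.map_mul, ← Matrix.mul_assoc, Matrix.mul_assoc (cWi.map C), ← hcN]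
        _ = N * cVi.map (C (σ := σ)) := by
            rw [← Matrix.mul_assoc, ← Matrix.map_mul, hcWicW, Matrix.map_one C C_0 C_1, Matrix.one_mul]
    -- `w : N → γB`, `z : γB → N`
    set wW : Matrix (Fin m) (Fin k) ℂ := (1 - vW * uW) * (Gm * vW) with hwW
    set wV : Matrix (Fin m) (Fin k) ℂ := (1 - vV * uV) * (Hm * vV) with hwV
    set zW : Matrix (Fin k) (Fin m) ℂ := cWi * (uW * (Gi * (1 - vW * uW))) with hzW
    set zV : Matrix (Fin k) (Fin m) ℂ := cVi * (uV * (Hi * (1 - vV * uV))) with hzV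
    have hw : wW.map (C (σ := σ)) * N = γB * wV.map (C (σ := σ)) := hom_comp (hom_comp hv hφ) hr
    have hz : zW.map (C (σ := σ)) * γB = N * zV.map (C (σ := σ)) :=
      hom_comp (hom_comp (hom_comp hr hφ') hu) hcinv
    have hzw : zW * wW = 1 := by
      have h1 : zW * wW = cWi * cW := by
        rw [hzW, hcW, hwW]
        simp only [Matrix.mul_assoc, hrr]
      rw [h1, hcWicW]
    have hur : uW * (1 - vW * uW) = 0 := by
      rw [Matrix.mul_sub, Matrix.mul_one, ← Matrix.mul_assoc, huvW, Matrix.one_mul, sub_self]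
    have hrv : (1 - vW * uW) * vW = 0 := by
      rw [Matrix.sub_mul, Matrix.one_mul, Matrix.mul_assoc, huvW, Matrix.mul_one, sub_self]
    have huw : uW * wW = 0 := by
      rw [hwW, ← Matrix.mul_assoc, hur, Matrix.zero_mul]
    have hzv : zW * vW = 0 := by
      rw [hzW]
      simp only [Matrix.mul_assoc]
      rw [hrv, Matrix.mul_zero, Matrix.mul_zero, Matrix.mul_zero]
    -- the retract `γN ⊕ N` of `γB`
    set D : Matrix (Fin k ⊕ Fin k) (Fin k ⊕ Fin k) (MvPolynomial σ ℂ) := Matrix.fromBlocks γN 0 0 N with hD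
    set VW : Matrix (Fin m) (Fin k ⊕ Fin k) ℂ := Matrix.fromCols vW wW with hVW
    set VV : Matrix (Fin m) (Fin k ⊕ Fin k) ℂ := Matrix.fromCols vV wV with hVV
    set UW : Matrix (Fin k ⊕ Fin k) (Fin m) ℂ := Matrix.fromRows uW zW with hUW
    set UV : Matrix (Fin k ⊕ Fin k) (Fin m) ℂ := Matrix.fromRows uV zV with hUV
    have hUVW : UW * VW = 1 := by
      rw [hUW, hVW, Matrix.fromRows_mul_fromCols, huvW, huw, hzv, hzw, Matrix.fromBlocks_one]
    have hurV : uV * (1 - vV * uV) = 0 := by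
      rw [Matrix.mul_sub, Matrix.mul_one, ← Matrix.mul_assoc, huvV, Matrix.one_mul, sub_self]
    have hrvV : (1 - vV * uV) * vV = 0 := by
      rw [Matrix.sub_mul, Matrix.one_mul, Matrix.mul_assoc, huvV, Matrix.mul_one, sub_self]
    have huwV : uV * wV = 0 := by
      rw [hwV, ← Matrix.mul_assoc, hurV, Matrix.zero_mul]
    have hzvV : zV * vV = 0 := by
      rw [hzV]
      simp only [Matrix.mul_assoc]
      rw [hrvV, Matrix.mul_zero, Matrix.mul_zero, Matrix.mul_zero]
    have hzwV : zV * wV = 1 := by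
      -- from `hz`, `hw`: `(zW wW) N = N (zV wV)` with `zW wW = 1`, and `det N ≠ 0`
      have h1 : (zW * wW).map (C (σ := σ)) * N = N * (zV * wV).map (C (σ := σ)) := hom_comp hw hz
      rw [hzw, Matrix.map_one C C_0 C_1, Matrix.one_mul] at h1
      -- `N * (1 - (zV wV)) = 0` with `det N ≠ 0`
      have hN0 : N.det ≠ 0 := by
        rw [hdetN]; exact mul_ne_zero (fun h0 => hc' (C_eq_zero.1 h0)) hf.ne_zero
      have h2 : N * ((1 : Matrix (Fin k) (Fin k) ℂ) - zV * wV).map (C (σ := σ)) = 0 := by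
        rw [Matrix.map_sub C (map_sub C), Matrix.mul_sub, ← h1, Matrix.map_one C C_0 C_1, Matrix.mul_one, sub_self]
      have h3 : ((1 : Matrix (Fin k) (Fin k) ℂ) - zV * wV).map (C (σ := σ)) = 0 := by
        have h4 := congrArg (fun X => N.adjugate * X) h2
        simp only [Matrix.mul_zero, ← Matrix.mul_assoc, Matrix.adjugate_mul, Matrix.smul_mul,
          Matrix.one_mul] at h4
        exact (smul_eq_zero.1 h4).resolve_left hN0
      have h5 : (1 : Matrix (Fin k) (Fin k) ℂ) - zV * wV = 0 := by
        ext i j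
        have := congrFun (congrFun h3 i) j
        simpa only [Matrix.map_apply, Matrix.zero_apply, C_eq_zero] using this
      rw [sub_eq_zero] at h5
      exact h5.symm
    have hUVV : UV * VV = 1 := by
      rw [hUV, hVV, Matrix.fromRows_mul_fromCols, huvV, huwV, hzvV, hzwV, Matrix.fromBlocks_one]
    have hVD : VW.map (C (σ := σ)) * D = γB * VV.map (C (σ := σ)) := by
      rw [hVW, hVV, hD, Matrix.fromCols_map, Matrix.fromCols_map, Matrix.fromCols_mul_fromBlocks,
        Matrix.mul_fromCols, Matrix.mul_zero, Matrix.mul_zero, add_zero, zero_add, hvγ, hw]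
    have hUD : UW.map (C (σ := σ)) * γB = D * UV.map (C (σ := σ)) := by
      rw [hUW, hUV, hD, Matrix.fromRows_map, Matrix.fromRows_map, Matrix.fromRows_mul,
        Matrix.fromBlocks_mul_fromRows, Matrix.zero_mul, Matrix.zero_mul, add_zero, zero_add, huγ, hz]
    -- determinants
    have hγf : ∀ A : Matrix (Fin m) (Fin m) (MvPolynomial σ ℂ), (Matrix.linSubstEntries γ A).det =
        linSubst σ ℂ (γ : Matrix σ σ ℂ) A.det := fun A => det_linSubstEntries γ A
    set γf := linSubst σ ℂ (γ : Matrix σ σ ℂ) f with hγf_def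
    have hdetγB : γB.det = C c * γf := by
      rw [hγB, det_linSubstEntries, hdetB, map_mul, linSubst_C]
    have hdetγN : γN.det = C c' * γf := by
      rw [hγN, det_linSubstEntries, hdetN, map_mul, linSubst_C]
    have hGdet : Gm.det ≠ 0 := by
      have h1 := congrArg Matrix.det hGiG
      rw [Matrix.det_mul, Matrix.det_one, mul_comm] at h1
      exact left_ne_zero_of_mul_eq_one h1
    have hHidet : Hi.det ≠ 0 := by
      have h1 := congrArg Matrix.det hHiH
      rw [Matrix.det_mul, Matrix.det_one] at h1
      exact left_ne_zero_of_mul_eq_one h1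
    have hγB0 : γB.det ≠ 0 := by
      rw [hlift, det_map_C_mul_mul_map_C, hdetB]
      exact mul_ne_zero (fun h0 => mul_ne_zero hGdet hHidet (C_eq_zero.1 h0))
        (mul_ne_zero (fun h0 => hc (C_eq_zero.1 h0)) hf.ne_zero)
    have hγf0 : γf ≠ 0 := by
      intro h0; apply hγB0; rw [hdetγB, h0, mul_zero]
    obtain ⟨q, c₀, hc₀, hq⟩ := exists_det_eq_mul_of_retract γB hγB0 D VW VV UW UV hVD hUD hUVW hUVV
    have hdetD : D.det = (C c' * γf) * (C c' * f) := by
      rw [hD, Matrix.det_fromBlocks_zero₂₁, hdetγN, hdetN]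
    rw [hdetD, hdetγB] at hq
    -- cancel `γf`: `f` divides a non-zero constant
    have hq' : γf * C (c₀ * c) = γf * (C (c' * c') * f * q) := by
      have : C c₀ * (C c * γf) = C c' * γf * (C c' * f) * q := hq
      calc γf * C (c₀ * c) = C c₀ * (C c * γf) := by rw [map_mul]; ring
        _ = C c' * γf * (C c' * f) * q := this
        _ = γf * (C (c' * c') * f * q) := by rw [map_mul]; ring
    have hcancel := mul_left_cancel₀ hγf0 hq'
    have hunit : IsUnit (C (c₀ * c) : MvPolynomial σ ℂ) := (IsUnit.mk0 _ (mul_ne_zero hc₀ hc)).map C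
    have hdvd : f ∣ C (c₀ * c) := ⟨C (c' * c') * q, by rw [hcancel]; ring⟩
    exact hf.not_isUnit (isUnit_of_dvd_unit hdvd hunit)

end Exchange

end Summit.ValiantsHypothesis.ValiantsHypothesis.Theorems.FreeSubtorusOrbitDimensionBound.SignCovering.PerSummand
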